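import Literature.AlgebraicTopology.SingularHomology.PoincareDualityCompactSupports
import Literature.AlgebraicTopology.SingularHomology.NoncompactManifoldProofs
import Literature.AlgebraicTopology.SingularHomology.OrientationCover
import Literature.AlgebraicTopology.SingularHomology.SimplyConnectedH1
import Literature.AlgebraicTopology.SingularHomology.FundamentalClassProofs
import Literature.AlgebraicTopology.SingularHomology.RelativeUniverseTransport
import Literature.AlgebraicTopology.Homotopy.WhiteheadContractibleProofs
import Literature.Topology.FourManifolds.HomotopyS4Smoothing
import Mathlib.Logic.Small.Basic
import HarnessLib

/-!
# Freedman 1982, Cor. 1.2: the homological hypotheses force contractibility (Siebenmann's remark)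

M. H. Freedman, *The topology of four-dimensional manifolds*, J. Differential Geom. **17** (1982),
Cor. 1.2 (p. 366) is printed in the homological form "`V` noncompact, `π₁(V) = 0 = H₂(V; ℤ)`, one
end, `π₁` stable and trivial at `∞` ⟹ `V ≅ ℝ⁴`", with the footnote/remark (attributed to
Siebenmann) that these hypotheses already make `V` CONTRACTIBLE, which is the form in which the
printed proof (p. 366: "By [Kirby–Siebenmann] `V` admits a smoothing", for open contractible
manifolds) uses them. This file PROVES that remark and reduces the tree's named fact
`Literature.Topology.FourManifolds.Freedman1982_nonempty_homeomorph_euclideanSpace_four` (Cor. 1.2,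
homological form) to (i) the smoothability of CONTRACTIBLE open topological 4-manifolds and (ii)
the smooth case `…_of_isManifold` (the proper h-cobordism theorem, Thm. 10.3), sharpening the
tree's glue `freedman1982_nonempty_homeomorph_euclideanSpace_four_of_smoothing`
(`HomotopyS4Smoothing.lean`, which asks for the smoothing of ALL connected noncompact 4-manifolds,
Freedman–Quinn Thm. 8.2) to the smoothing input the printed proof actually cites.

The contractibility is `π₁ = 0` plus `H̃_*(V; ℤ) = 0` (the tree's proved Whitehead–Hurewicz
recognition principle for manifolds, `contractibleSpace_of_simplyConnected_of_acyclic_holds`,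
Bredon VII Cor. 10.11) where: `H₁ = 0` by simple connectivity (`SimplyConnectedH1`), `H₂ = 0` by
hypothesis, `Hₖ = 0` for `k ≥ 4` by Hatcher Prop. 3.29 (`NoncompactManifoldProofs`), and — the
point — **`H₃(V; ℤ) = 0` by Poincaré duality with compact supports** (Hatcher Thm. 3.35,
`PoincareDualityCompactSupports.lean`): `H₃(V) ≅ H¹_c(V) = lim_K H¹(V, V ∖ K)`, and for a simply
connected (`H¹(V) = 0`) ONE-ENDED `V` every class of `H¹(V, V ∖ K)` dies in `H¹(V, V ∖ L)` for the
compact `L ⊇ K` with connected complement provided by one-endedness (a `1`-cocycle vanishing off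
`K` is `δf` with `f` constant on the path connected `V ∖ L`; subtract the constant). The
hypothesis "one end" is thus genuinely used (`S³ × ℝ` has `H₃ ≠ 0`).

Main results:

* `subsingleton_Hc_one_of_oneEnded` — `H¹_c(X; R) = 0` for a simply connected one-ended
  manifold `X : Type` (`R` a PID);
* `isZero_singularHomology_pred_of_oneEnded` — `H_{n-1}(X; R) = 0` for a simply connected
  one-ended `n`-manifold `X : Type`, `n ≥ 1`;
* **`contractibleSpace_of_oneEnded`** — a simply connected noncompact topological 4-manifold
  `V : Type u` with `H₂(V; ℤ) = 0` and one end is contractible;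
* **`freedman1982_nonempty_homeomorph_euclideanSpace_four_of_contractible_smoothing`** — Cor. 1.2
  from the smoothing of contractible open 4-manifolds and its smooth case.

Everything is proved; no definitions, no new named facts (the universe change in
`contractibleSpace_of_oneEnded` uses the tree's `singularHomology.equivOfHomeomorph`).

## References

* M. H. Freedman, J. Differential Geom. 17 (1982) 357–453, Cor. 1.2 p. 366 and §10 p. 436.
  [FreedmanJDG1982]
* A. Hatcher, *Algebraic Topology*, CUP 2002, Thm. 3.35, Prop. 3.29, Prop. 3.25. [HatcherAT2002]
-/

noncomputable section

-- as in `SingularChainsConcrete`: chains of the concrete complex are `Finsupp`s up to unfolding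
set_option backward.isDefEq.respectTransparency false

open CategoryTheory Limits Set
open scoped Manifold ContDiff

universe u v

namespace Literature.Topology.FourManifolds

open Literature.AlgebraicTopology.SingularHomology

/-- Local notation: `𝔼 n` is the model Euclidean space `EuclideanSpace ℝ (Fin n)`. -/
local notation "𝔼 " n:arg => EuclideanSpace ℝ (Fin n)

/-! ### `H¹_c = 0` for simply connected one-ended manifolds -/

section HcOne

variable {R : Type v} [CommRing R] [IsDomain R] [IsPrincipalIdealRing R]
variable {X : Type} [TopologicalSpace X]

omit [IsDomain R] [IsPrincipalIdealRing R] in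
/-- `(δ f)(γ) = f(γ(1)) - f(γ(0))` for a path `γ` read as a singular `1`-simplex. [folklore] -/
lemma singularCochainComplex_d_zero_ofPath (f : SingularSimplex X 0 → R) {x y : X} (γ : Path x y) :
    (singularCochainComplex R R X).d 0 1 f (SingularSimplex.ofPath γ) =
      f (SingularSimplex.ofPoint y) - f (SingularSimplex.ofPoint x) := by
  rw [singularCochainComplex.d_apply, Fin.sum_univ_two, SingularSimplex.ofPath_face_zero,
    SingularSimplex.ofPath_face_one]
  simp [sub_eq_add_neg]

/-- **On a simply connected space every `1`-cocycle is a coboundary** (in the function-cochain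
model): `H₁(X; R) = 0` (Hurewicz, the tree's `isZero_singularHomology_one_of_simplyConnectedSpace`)
and `H₀(X; R) ≅ R` is projective, so the `Ext`-free universal coefficient argument
(`exists_rel_d_eq_of_kill` with `A = ∅`) applies. [cite: HatcherAT2002, §3.1 Thm. 3.2 (p. 195)] -/
theorem exists_d_eq_of_cocycle_one [SimplyConnectedSpace X] (φ : SingularSimplex X 1 → R)
    (hφ : (singularCochainComplex R R X).d 1 2 φ = 0) :
    ∃ f : SingularSimplex X 0 → R, (singularCochainComplex R R X).d 0 1 f = φ := by
  -- `H₁ = 0` in the concrete model: cycles are boundaries, so `φ` kills the (relative-to-`∅`) cycles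
  have h1 : IsZero ((csingularChainComplex R R X).homology 1) :=
    (isZero_singularHomology_one_of_simplyConnectedSpace R R (X := X)).of_iso (csingularHomology.compIso R R X 1)
  haveI := ModuleCat.subsingleton_of_isZero h1
  have hkill : ∀ x : CChain R X 1, x ∈ relZ R (∅ : Set X) 1 → Finsupp.linearCombination R φ x = 0 := by
    intro x hx
    rw [mem_relZ_iff, ChainComplex.next_nat_succ] at hx
    have hdx : (csingularChainComplex R R X).d 1 0 x = 0 := eq_zero_of_mem_chainsIn_empty R R hx
    have hdx' : (csingularChainComplex R R X).d 1 ((ComplexShape.down ℕ).next 1) x = 0 := by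
      rw [ChainComplex.next_nat_succ]; exact hdx
    have h0 : homologyCls (K := csingularChainComplex R R X) x hdx' = 0 := Subsingleton.elim _ _
    rw [homologyCls_eq_zero_iff, exists_d_prev_eq_iff (ChainComplex.prev ℕ 1)] at h0
    obtain ⟨w, rfl⟩ := h0
    rw [linearCombination_d, hφ, Finsupp.linearCombination_zero, LinearMap.zero_apply]
  -- `H₀(C(X)/C(∅)) ≅ H₀(X; R) ≅ R` is projective
  have hproj : Module.Projective R ((chainsInSub R R X (∅ : Set X)).quotient.homology 0) := by
    haveI := singularHomology.isIso_ε_of_pathConnectedSpace R R (X := X)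
    haveI : Module.Free R (singularHomology R R X 0) :=
      Module.Free.of_equiv (asIso (singularHomology.ε R R X)).toLinearEquiv.symm
    haveI := isIso_π_awaySub_univ R R (X := X)
    let e : singularHomology R R X 0 ≃ₗ[R] (chainsInSub R R X (Set.univ : Set X)ᶜ).quotient.homology 0 :=
      (csingularHomology.compIso R R X 0).symm.toLinearEquiv.trans
        (asIso (HomologicalComplex.homologyMap (awaySub R R X Set.univ).π 0)).toLinearEquiv
    rw [Set.compl_univ] at e
    haveI : Module.Free R ((chainsInSub R R X (∅ : Set X)).quotient.homology 0) := Module.Free.of_equiv e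
    exact Module.Projective.of_free
  obtain ⟨f, -, hf⟩ := exists_rel_d_eq_of_kill (A := (∅ : Set X)) (m := 0) hproj φ hkill
  exact ⟨f, hf⟩

/-- **`H¹_c(X; R) = 0` for a simply connected one-ended Hausdorff locally path connected space**
(e.g. a manifold; `X : Type`, `R` a PID): a
class of `H¹(X, X ∖ K)` is represented by a `1`-cocycle `φ` vanishing off the compact `K`;
`φ = δf` (`H¹(X) = 0`), `f` is constant on the connected — hence path connected — complement of
the compact `L ⊇ K` given by one-endedness, and subtracting that constant exhibits the image of
the class in `H¹(X, X ∖ L)` as zero; so it vanishes in the limit `H¹_c(X)` (Freedman 1982, the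
remark after Cor. 1.2; Hatcher 2002, §3.3 pp. 242–245 for `Hⁱ_c` as the limit).
[cite: FreedmanJDG1982, Cor. 1.2 p. 366] [cite: HatcherAT2002, §3.3 p. 244] -/
theorem subsingleton_Hc_one_of_oneEnded [T2Space X] [LocallyPathConnectedSpace X] [SimplyConnectedSpace X]
    (hE : OneEnded X) : Subsingleton (Hc R R (Set.univ : Set X) 1) := by
  refine ⟨fun u v => ?_⟩
  suffices h0 : ∀ u : Hc R R (Set.univ : Set X) 1, u = 0 by rw [h0 u, h0 v]
  intro u
  obtain ⟨K, γ, rfl⟩ := Hc.exists_of u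
  obtain ⟨L, hLc, hKL, hLconn⟩ := hE K.carrier K.isCompact
  let L' : CompactSub X (Set.univ : Set X) := ⟨L, hLc, Set.subset_univ _⟩
  have hle : K ≤ L' := hKL
  rw [← Hc.of_ext hle]
  -- the class `γ = [ψ]`, `φ = val ψ` a `1`-cocycle vanishing on the simplices of `X ∖ K`
  obtain ⟨ψ, hψ, rfl⟩ := homologyCls_surjective γ
  set φ : SingularSimplex X 1 → R := relCochainComplex.val ψ with hφdef
  have hψ2 : (relCochainComplex R R K.carrierᶜ).d 1 2 ψ = 0 := by
    have := hψ; rwa [CochainComplex.next] at this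
  have hdφ : (singularCochainComplex R R X).d 1 2 φ = 0 := by
    rw [hφdef, ← relCochainComplex.val_d, hψ2, relCochainComplex.val_zero]
  obtain ⟨f, hf⟩ := exists_d_eq_of_cocycle_one φ hdφ
  -- `f` is constant on the path connected `Lᶜ`
  have hLpc : IsPathConnected Lᶜ := (hLc.isClosed.isOpen_compl.isConnected_iff_isPathConnected).mp hLconn
  obtain ⟨y₀, hy₀⟩ := hLconn.nonempty
  set c₀ : R := f (SingularSimplex.ofPoint y₀) with hc₀
  have hconst : ∀ y ∈ Lᶜ, f (SingularSimplex.ofPoint y) = c₀ := by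
    intro y hy
    obtain ⟨γ, hγ⟩ := hLpc.joinedIn y₀ hy₀ y hy
    have hrange : (SingularSimplex.ofPath γ).range ⊆ K.carrierᶜ :=
      (SingularSimplex.range_ofPath_subset γ).trans (by
        rintro _ ⟨t, rfl⟩; exact fun hK => hγ t (hKL hK))
    have h0 : φ (SingularSimplex.ofPath γ) = 0 := relCochainComplex.val_mem ψ _ hrange
    rw [← hf, singularCochainComplex_d_zero_ofPath] at h0
    exact (sub_eq_zero.mp h0)
  -- `g = f - c₀` vanishes on `Lᶜ` and `δ g = φ`
  let g : SingularSimplex X 0 → R := fun σ => f σ - c₀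
  have hg : g ∈ relCochains R R L'.carrierᶜ 0 := by
    intro σ hσ
    have hpt : σ.pt ∈ Lᶜ := by
      have : σ.range ⊆ Lᶜ := hσ
      rwa [SingularSimplex.range_eq_pt, Set.singleton_subset_iff] at this
    change f σ - c₀ = 0
    rw [← SingularSimplex.ofPoint_pt σ, hconst _ hpt, sub_self]
  have hdg : (singularCochainComplex R R X).d 0 1 g = φ := by
    have e : g = f - fun _ => c₀ := rfl
    rw [e, map_sub, hf, singularCochainComplex.d_const_eq_zero, sub_zero]
  -- hence `ext [ψ] = [δ g] = 0`
  have key : ∀ hψ', homologyCls (K := relCochainComplex R R L'.carrierᶜ)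
      ((relCochainComplex.extCompl R R (K := K.carrier) (L := L'.carrier) hle).f 1 ψ) hψ' = 0 := by
    intro hψ'
    refine (homologyCls_eq_zero_iff _ _).mpr ((exists_d_prev_eq_iff (CochainComplex.prev_nat_succ 0) _).mpr
      ⟨relCochainComplex.mk g hg, relCochainComplex.val_injective ?_⟩)
    rw [relCochainComplex.val_d, relCochainComplex.val_mk, hdg]
    rfl
  rw [extH, homologyMap_homologyCls, key, map_zero]

/-- **`H_{n-1}(X; R) = 0` for a simply connected one-ended `n`-manifold** `X : Type`, `n ≥ 1`,
`R` a PID: Poincaré duality with compact supports (Hatcher Thm. 3.35, `poincareDuality_compactSupports`,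
the orientation from simple connectivity, Prop. 3.25) identifies it with `H¹_c(X; R) = 0`.
[cite: HatcherAT2002, Thm. 3.35] [cite: FreedmanJDG1982, Cor. 1.2 p. 366] -/
theorem isZero_singularHomology_pred_of_oneEnded [T2Space X] {n' : ℕ} [ChartedSpace (𝔼 (n' + 1)) X]
    [SimplyConnectedSpace X] (hE : OneEnded X) : IsZero (singularHomology R R X n') := by
  haveI : LocallyPathConnectedSpace X := ChartedSpace.locallyPathConnectedSpace (𝔼 (n' + 1)) X
  obtain ⟨μ⟩ := isOrientableOver_of_simplyConnectedSpace R X (n := n' + 1)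
  have hn : 1 ≤ n' + 1 := Nat.succ_pos n'
  have hD := HomologicalOrientation.poincareDuality_compactSupports hn μ (p := 1) (q := n') (by omega)
  haveI := subsingleton_Hc_one_of_oneEnded (R := R) (X := X) hE
  haveI : Subsingleton ((chainsInSub R R X (Set.univ : Set X)).toComplex.homology n') :=
    ⟨fun a b => by
      obtain ⟨a', rfl⟩ := hD.2 a
      obtain ⟨b', rfl⟩ := hD.2 b
      rw [Subsingleton.elim a' b']⟩
  -- `H(C(univ)) ≅ H(C(X)) ≅ Hₙ'(X; R)`
  haveI : IsIso (chainsInSub R R X (Set.univ : Set X)).ι := by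
    rw [chainsInSub_univ]; infer_instance
  have e : (chainsInSub R R X (Set.univ : Set X)).toComplex.homology n' ≅ singularHomology R R X n' :=
    asIso (HomologicalComplex.homologyMap (chainsInSub R R X (Set.univ : Set X)).ι n') ≪≫ csingularHomology.compIso R R X n'
  exact (ModuleCat.isZero_of_subsingleton _).of_iso e.symm

end HcOne

/-! ### Siebenmann's remark: the hypotheses of Cor. 1.2 force contractibility -/

/-- **Contractibility from the hypotheses of Freedman's Cor. 1.2, spaces in `Type`**: a simply
connected noncompact Hausdorff second-countable topological 4-manifold `V : Type` with
`H₂(V; ℤ) = 0` and one end is contractible (`H₁ = 0` by `π₁ = 0`; `H₂ = 0`; `H₃ = 0` by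
Poincaré duality with compact supports and one-endedness; `Hₖ = 0`, `k ≥ 4`, Hatcher Prop. 3.29;
then the Whitehead–Hurewicz recognition principle for manifolds).
[cite: FreedmanJDG1982, Cor. 1.2 p. 366] [cite: HatcherAT2002, Thm. 3.35] -/
theorem contractibleSpace_of_oneEnded_type (V : Type) [TopologicalSpace V] [T2Space V]
    [SecondCountableTopology V] [ChartedSpace (𝔼 4) V] [NoncompactSpace V] [SimplyConnectedSpace V]
    (hH : IsZero (singularHomology ℤ ℤ V 2)) (hE : OneEnded V) : ContractibleSpace V := by
  refine Literature.AlgebraicTopology.Homotopy.Manifold.contractibleSpace_of_simplyConnected_of_acyclic_holds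
    4 V fun k hk => ?_
  rcases Nat.lt_or_ge k 4 with hk4 | hk4
  · interval_cases k
    · exact isZero_singularHomology_one_of_simplyConnectedSpace ℤ ℤ
    · exact hH
    · exact isZero_singularHomology_pred_of_oneEnded (R := ℤ) (n' := 3) hE
  · exact clocalHomology.isZero_singularHomology_of_noncompact ℤ ℤ hk4

/-- **Contractibility from the hypotheses of Freedman's Cor. 1.2** (every universe): a simply
connected noncompact Hausdorff second-countable topological 4-manifold `V : Type u` with
`H₂(V; ℤ) = 0` and one end is contractible — the remark printed after Cor. 1.2 (Freedman 1982,
p. 366; §10 p. 436), by which the printed proof treats `V` as an open contractible manifold.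
Reduced to `contractibleSpace_of_oneEnded_type` on the small copy `Shrink.{0} V`.
[cite: FreedmanJDG1982, Cor. 1.2 p. 366] -/
theorem contractibleSpace_of_oneEnded (V : Type u) [TopologicalSpace V] [T2Space V]
    [SecondCountableTopology V] [ChartedSpace (𝔼 4) V] [NoncompactSpace V] [SimplyConnectedSpace V]
    (hH : IsZero (singularHomology ℤ ℤ V 2)) (hE : OneEnded V) : ContractibleSpace V := by
  haveI : Small.{0} V := small_of_secondCountableTopology V
  let φ : V ≃ₜ Shrink.{0} V := Shrink.homeomorph V
  haveI : T2Space (Shrink.{0} V) := φ.t2Space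
  haveI : SecondCountableTopology (Shrink.{0} V) := φ.symm.secondCountableTopology
  letI : ChartedSpace V (Shrink.{0} V) := φ.symm.toOpenPartialHomeomorph.singletonChartedSpace rfl
  letI : ChartedSpace (𝔼 4) (Shrink.{0} V) := ChartedSpace.comp (𝔼 4) V (Shrink.{0} V)
  haveI : NoncompactSpace (Shrink.{0} V) := not_compactSpace_iff.mp fun h =>
    (not_compactSpace_iff.mpr ‹NoncompactSpace V›) (@Homeomorph.compactSpace _ _ _ _ h φ.symm)
  haveI : SimplyConnectedSpace (Shrink.{0} V) := φ.toHomotopyEquiv.simplyConnectedSpace_iff.1 ‹_›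
  have hH' : IsZero (singularHomology ℤ ℤ (Shrink.{0} V) 2) := by
    haveI := ModuleCat.subsingleton_of_isZero hH
    haveI : Subsingleton (singularHomology ℤ ℤ (Shrink.{0} V) 2) :=
      (singularHomology.equivOfHomeomorph ℤ ℤ φ 2).symm.subsingleton
    exact ModuleCat.isZero_of_subsingleton _
  haveI := contractibleSpace_of_oneEnded_type (Shrink.{0} V) hH' (OneEnded.of_homeomorph φ hE)
  exact φ.contractibleSpace

/-! ### Cor. 1.2 over the smoothing of contractible open 4-manifolds -/

/-- **Freedman 1982, Cor. 1.2 (homological form) from the smoothing of CONTRACTIBLE open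
4-manifolds and its smooth case.** GIVEN (i) that every contractible noncompact Hausdorff
second-countable topological 4-manifold admits a smooth structure (the input the printed proof
cites: "By [Kirby–Siebenmann] `V` admits a smoothing `V_Σ`", p. 366 — for open contractible
manifolds; a special case of Freedman–Quinn Thm. 8.2) and (ii) Cor. 1.2 for smooth `V` (the tree's
named fact `Freedman1982_nonempty_homeomorph_euclideanSpace_four_of_isManifold`, i.e. the proper
h-cobordism theorem Thm. 10.3), the homological Cor. 1.2 follows: by `contractibleSpace_of_oneEnded`
the hypotheses make `V` contractible, so (i) smooths it, and (ii) applies to `V_Σ` ("`ℝ⁴ ≅_Top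
V_Σ ≅_Top V`"). This sharpens `freedman1982_nonempty_homeomorph_euclideanSpace_four_of_smoothing`.
[cite: FreedmanJDG1982, Cor. 1.2 p. 366 (statement, remark and proof)] -/
theorem freedman1982_nonempty_homeomorph_euclideanSpace_four_of_contractible_smoothing
    (hs : ∀ (V : Type u) [TopologicalSpace V] [T2Space V] [SecondCountableTopology V]
      [ChartedSpace (𝔼 4) V] [ContractibleSpace V] [NoncompactSpace V],
      ∃ c : ChartedSpace (𝔼 4) V, @IsManifold ℝ _ _ _ _ _ _ (𝓡 4) ∞ V _ c)
    (hr : Freedman1982_nonempty_homeomorph_euclideanSpace_four_of_isManifold.{u}) :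
    Freedman1982_nonempty_homeomorph_euclideanSpace_four.{u} := by
  intro V _ _ _ _ _ _ hH hE hU
  haveI : ContractibleSpace V := contractibleSpace_of_oneEnded V hH hE
  obtain ⟨c, hc⟩ := hs V
  exact @hr V _ _ _ c hc _ _ hH hE hU

end Literature.Topology.FourManifolds
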